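import Mathlib
import Literature.Analysis.FluidPDE.BoltzmannEquation
import Literature.MathematicalPhysics.KineticTheory.HardSphereEuler

/-!
# Sketch — first lemmas for crux ideas on `KineticCurrentsWindowLDUniform` (stmt-AtomisticToContinuum-14662)

Ideator 2, round 1. Statements only (`def … : Prop`), over existing declarations; they must elaborate.

* `StaticHydroDomination` — card `local-gibbs-entropy-ledger`: the Maxwellian average of a fast functional of
  quadratic growth is dominated by the Gaussian relative entropy of the Maxwellian's parameters (second-order
  vanishing at the reference parameters is exactly the three orthogonality clauses of the crux).
* `HeteroProductEntropySubadditivity` — card `local-gibbs-entropy-ledger`: subadditivity of `klDiv` over a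
  heterogeneous product reference (the velocity fibre of a local Gibbs law, given the positions).
* `LiouvilleTransportDensity` — card `quasi-invariance-cocycle`: push-forward of a density by a measure-preserving
  equivalence (the formal core of the Radon–Nikodym cocycle of local Gibbs along the hard-sphere flow).
* `JensenTimeTruncation` — card `quasi-invariance-cocycle`: the exponential moment of a window AVERAGE of a
  non-negative path functional is bounded by the worst single-time exponential moment (Jensen in time + Tonelli).
-/

noncomputable section

open MeasureTheory ProbabilityTheory InformationTheory Real
open scoped ENNReal

namespace Summit.AtomisticToContinuum.HydrodynamicLimit.Cruxes.KineticCurrentsWindowLDUniform.IdeatorTwo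

open Literature.MathematicalPhysics.KineticTheory (V3 T3)
open Literature.Analysis.FluidPDE (localMaxwellian)

/-- STATIC HYDRODYNAMIC DOMINATION (first lemma of card `local-gibbs-entropy-ledger`). For a continuous velocity
functional `F` of quadratic growth, orthogonal under `M_{1,u₀,θ₀}` to `1, v_j, ‖v‖²`, the average of `F` under ANY
Maxwellian `M_{1,u,θ}` is bounded by `K_F` times the Gaussian relative entropy
`H(N(u,θI) ‖ N(u₀,θ₀I)) = ‖u-u₀‖²/(2θ₀) + (3/2)(θ/θ₀ - 1 - log(θ/θ₀))`.
(The map `(u,θ) ↦ ∫ F M_{1,u,θ}` is smooth, vanishes at `(u₀,θ₀)` by `⊥ 1`, has zero gradient there by `⊥ v_j`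
and `⊥ ‖v‖²`, is `O(1 + ‖u‖² + θ)` globally by the growth bound; the entropy is uniformly convex at `(u₀,θ₀)`,
`≥ ‖u-u₀‖²/(2θ₀)`, `≥ (3/4)θ/θ₀` for `θ ≥ 4θ₀`, and `→ ∞` as `θ → 0`.) `K_F⁻¹` is the card's `β₀`. -/
def StaticHydroDomination : Prop :=
  ∀ (θ₀ : ℝ), 0 < θ₀ → ∀ (u₀ : V3) (F : V3 → ℝ), Continuous F →
    ∀ C : ℝ, (∀ v, |F v| ≤ C * (1 + ‖v‖ ^ 2)) →
    (∫ v, F v * localMaxwellian 1 θ₀ u₀ v = 0) →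
    (∀ j : Fin 3, ∫ v, F v * v j * localMaxwellian 1 θ₀ u₀ v = 0) →
    (∫ v, F v * ‖v‖ ^ 2 * localMaxwellian 1 θ₀ u₀ v = 0) →
    ∃ K : ℝ, 0 ≤ K ∧ ∀ (u : V3) (θ : ℝ), 0 < θ →
      |∫ v, F v * localMaxwellian 1 θ u v| ≤
        K * (‖u - u₀‖ ^ 2 / (2 * θ₀) + 3 / 2 * (θ / θ₀ - 1 - Real.log (θ / θ₀)))

/-- HETEROGENEOUS-PRODUCT ENTROPY SUBADDITIVITY (second lemma of card `local-gibbs-entropy-ledger`). For a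
probability law `P` of `n` velocities and a PRODUCT reference `⊗ᵢ γᵢ` of possibly different probability measures
(the velocity fibre of a local Gibbs law given the positions: `γᵢ = N(u₀(xᵢ), θ₀(xᵢ) I)`), the sum of the marginal
relative entropies is at most the joint one: `Σᵢ KL(Pⁱ ‖ γᵢ) ≤ KL(P ‖ ⊗ᵢ γᵢ)` (chain rule + convexity). -/
def HeteroProductEntropySubadditivity : Prop :=
  ∀ (V : Type) [MeasurableSpace V] (n : ℕ) (γ : Fin n → Measure V), (∀ i, IsProbabilityMeasure (γ i)) →
    ∀ (P : Measure (Fin n → V)), IsProbabilityMeasure P →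
      (∑ i : Fin n, klDiv (P.map fun v => v i) (γ i)) ≤ klDiv P (Measure.pi γ)

/-- LIOUVILLE TRANSPORT OF A DENSITY (first lemma of card `quasi-invariance-cocycle`). If `T` is a measurable
equivalence preserving `ν` (the hard-sphere flow map at time `t` and the Liouville measure), then the push-forward
of the law `ψ·ν` (a local Gibbs law) is `(ψ ∘ T⁻¹)·ν`; hence `dλ_t/dλ = ψ∘T⁻¹/ψ` on `{ψ > 0}`, and for the local Gibbs
density `log(ψ∘Φ₋ₜ/ψ)` is minus the window functional given by the tree's balance law
`HardSphereFlow.sub_eq_integral_add_collisionalTransfer` applied to `log ψ = Σᵢ log(a(xᵢ) M_{xᵢ}(vᵢ))`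
(streaming part: a member of the crux's class plus conserved-class terms; collisional part: `O(ε_N)` per record). -/
def LiouvilleTransportDensity : Prop :=
  ∀ (Ω : Type) [MeasurableSpace Ω] (ν : Measure Ω) (T : Ω ≃ᵐ Ω), MeasurePreserving T ν ν →
    ∀ ψ : Ω → ℝ≥0∞, Measurable ψ →
      (ν.withDensity ψ).map T = ν.withDensity (ψ ∘ T.symm)

/-- JENSEN-IN-TIME TRUNCATION (second lemma of card `quasi-invariance-cocycle`). For a NON-NEGATIVE jointly
measurable path functional `(r, ω) ↦ X (T r ω)` and a window `w > 0`, the exponential moment of the window average is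
at most the worst single-time exponential moment: `∫ exp(w⁻¹∫₀ʷ X(T_r ω) dr) dμ ≤ sup_{r ∈ [0,w]} ∫ exp(X(T_r ω)) dμ`
(convexity of `exp`, Tonelli; junk-safe because `X ≥ 0` makes both sides `≥ 1`). With `X = β C(1+‖vᵢ‖²)𝟙{‖vᵢ‖>M}`
summed over particles and `LiouvilleTransportDensity`, the quadratic tails of the crux's functional are priced by a
STATIC Gaussian tail at time `0` plus the `o(N)` pressure of the cocycle. -/
def JensenTimeTruncation : Prop :=
  ∀ (Ω : Type) [MeasurableSpace Ω] (μ : Measure Ω), IsProbabilityMeasure μ →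
    ∀ (T : ℝ → Ω → Ω) (X : Ω → ℝ), (∀ ω, 0 ≤ X ω) →
      Measurable (fun p : ℝ × Ω => X (T p.1 p.2)) →
      ∀ w : ℝ, 0 < w →
        ∫⁻ ω, ENNReal.ofReal (Real.exp (w⁻¹ * ∫ r in (0 : ℝ)..w, X (T r ω))) ∂μ ≤
          ⨆ r ∈ Set.Icc (0 : ℝ) w, ∫⁻ ω, ENNReal.ofReal (Real.exp (X (T r ω))) ∂μ

/-! ### Sanity instances (checkability of the frames) -/

/-- The entropy weight of `StaticHydroDomination` vanishes at the reference parameters. -/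
theorem entropyWeight_self (θ₀ : ℝ) (hθ : 0 < θ₀) (u₀ : V3) :
    ‖u₀ - u₀‖ ^ 2 / (2 * θ₀) + 3 / 2 * (θ₀ / θ₀ - 1 - Real.log (θ₀ / θ₀)) = 0 := by
  simp [div_self hθ.ne']

/-- The entropy weight of `StaticHydroDomination` is non-negative (`s - 1 - log s ≥ 0`). -/
theorem entropyWeight_nonneg (θ₀ : ℝ) (hθ₀ : 0 < θ₀) (u u₀ : V3) (θ : ℝ) (hθ : 0 < θ) :
    0 ≤ ‖u - u₀‖ ^ 2 / (2 * θ₀) + 3 / 2 * (θ / θ₀ - 1 - Real.log (θ / θ₀)) := by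
  have h1 : 0 ≤ ‖u - u₀‖ ^ 2 / (2 * θ₀) := by positivity
  have h2 : 0 ≤ θ / θ₀ - 1 - Real.log (θ / θ₀) := by
    have hs : 0 < θ / θ₀ := div_pos hθ hθ₀
    have := Real.add_one_le_exp (Real.log (θ / θ₀))
    rw [Real.exp_log hs] at this
    linarith
  nlinarith

/-- `LiouvilleTransportDensity` holds (Mathlib-only; the formal core of the cocycle). -/
theorem liouvilleTransportDensity_holds : LiouvilleTransportDensity := by
  intro Ω _ ν T hT ψ hψ
  ext s hs
  rw [Measure.map_apply T.measurable hs, withDensity_apply _ (T.measurable hs), withDensity_apply _ hs]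
  have h := hT.setLIntegral_comp_preimage_emb T.measurableEmbedding (ψ ∘ T.symm) s
  have h' : ∀ a, (ψ ∘ T.symm) (T a) = ψ a := fun a => by simp
  simp_rw [h'] at h
  exact h

end Summit.AtomisticToContinuum.HydrodynamicLimit.Cruxes.KineticCurrentsWindowLDUniform.IdeatorTwo
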